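import Mathlib
import HarnessLib

/-!
# Zhang (2022), §4: the Gaussian-smoothed Perron weight `g(x)` and `ω₁(w)` — (4.1)–(4.3),
# kernel-checked

Topic `Literature/NumberTheory/LFunctions/Zhang2022` (Landau–Siegel autopsy tree; verdict-neutral).
Y. Zhang, *Discrete mean estimates and the Landau–Siegel zero*, arXiv:2211.02515v1 (2022) — **an
unrefereed manuscript, a claimed result under adjudication** (cell pub-zhang: audit + repair census
of arXiv:2211.02515; no claim about Landau–Siegel) — §4, between Lemma 4.3 and (4.4) [p. 8]:

> We proceed to establish an approximate formula for `L(s,ψ)L(s,χψ)`. For this purpose we first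
> introduce a weight `g(x)` that will find application at various places. Let
> `g(x) = (2πi)⁻¹ ∫_{(c)} x^w ω₁(w) dw/w  (c > 0)` with `ω₁(w) = exp{w²/(4𝓛³⁰)}`.
> We may write `g(x) = (2πi)⁻¹ ∫_{(c)} (∫₀ˣ y^{w−1} dy) ω₁(w) dw`. Since
> `(2πi)⁻¹ ∫_{(c)} exp{(log y)w + w²/(4𝓛³⁰)} dw = (𝓛¹⁵/√π) exp{−𝓛³⁰(log y)²}`,
> it follows, by changing the order of integration, that
> `g(x) = (𝓛¹⁵/√π) ∫₀ˣ exp{−𝓛³⁰(log y)²} dy/y`. This yields, by substituting `t = 𝓛¹⁵ log y`,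
> `g(x) = (1/√π) ∫_{−∞}^{𝓛¹⁵ log x} exp{−t²} dt.`                                         (4.1)
> Thus the function `g(x)` is increasing and it satisfies `0 < g(x) < 1`. Further we have
> `g(x) = 1 + O(exp{−𝓛³⁰ log²x})` if `x ≥ 1`                                             (4.2)
> and `g(x) = O(exp{−𝓛³⁰ log²x})` if `x ≤ 1`.                                              (4.3)

(The weight is then consumed in Lemma 4.4, Lemma 5.7, §6 and §11 through the Mellin identity
`(2πi)⁻¹∫_{(c)} (∑ₙ aₙ n^{−s−w}) X^w ω₁(w) dw/w = ∑ₙ aₙ n^{−s} g(X/n)`.)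

This file PROVES all of the above for a general variance parameter `Λ > 0` in place of `𝓛³⁰`
(`ω₁(w) = exp{w²/(4Λ)}`), following the printed argument step by step, with explicit constants:

* `omega1 Λ w = exp{w²/(4Λ)}`; `gWeight Λ x = √(Λ/π) ∫_{u ≤ log x} e^{−Λu²} du` — which is (4.1)
  after `t = √Λ·u` (`gWeight_eq_erf_form`: `g(x) = (1/√π)∫_{−∞}^{√Λ log x} e^{−t²} dt`);
* **`gWeight_eq_verticalIntegral`** — the source's DEFINITION of `g` recovered as a theorem:
  for `Λ > 0`, `c > 0`, `x > 0`,
  `(1/2π) ∫_ℝ x^{c+it} ω₁(c+it) (c+it)⁻¹ dt = g(x)`, i.e. `(2πi)⁻¹∫_{(c)} x^w ω₁(w) dw/w = g(x)`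
  (the printed route: `x^w/w = ∫_{u ≤ log x} e^{wu} du` (`cpow_div_eq_integral`, the source's
  `∫₀ˣ y^{w−1}dy` after `y = e^u`), Fubini (`integrable_fub`), and the Gaussian line integral
  `∫_ℝ ω₁(c+it) e^{(c+it)u} dt = √(4πΛ) e^{−Λu²}` (`integral_omega1_mul_exp`, Mathlib's
  `integral_cexp_quadratic`) — the source's "`(2πi)⁻¹∫_{(c)} exp{(log y)w + w²/(4𝓛³⁰)} dw =
  (𝓛¹⁵/√π) exp{−𝓛³⁰ log²y}`");
* `gWeight_pos`, `gWeight_lt_one`, `gWeight_mono` (`0 < g < 1`, `g` increasing);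
* (4.2) `abs_gWeight_sub_one_le`: `x ≥ 1 ⇒ |g(x) − 1| ≤ ½·exp{−Λ log²x}`;
  (4.3) `gWeight_le`: `0 < x ≤ 1 ⇒ g(x) ≤ ½·exp{−Λ log²x}` (Gaussian tail `integral_gauss_Ioi_le`);
* `integral_LSeries_mul_kernel` — the form in which the weight is USED (e.g. the first display of
  the proof of Lemma 4.4, and Lemma 5.7): for an `L`-series `L(a,·)` absolutely convergent at
  `s + c`, `(1/2π)∫_ℝ L(a, s+c+it) X^{c+it} ω₁(c+it)(c+it)⁻¹ dt = ∑ₙ aₙ n^{−s} g(X/n)`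
  (termwise by the main theorem; the interchange by `integral_tsum_of_summable_integral_norm`).

Only definitions of the manuscript are used; nothing about its Theorems 1–2 is stated or implied,
and nothing here bears on the cell's verdict on (8.24) (`Section8Certificate.not_ineq824`).

## References

* Y. Zhang, arXiv:2211.02515v1 (2022), §4 p. 8, (4.1)–(4.3).
  [cite: Zhang2022LandauSiegel, §4 (4.1)–(4.3)]
* H. L. Montgomery, R. C. Vaughan, *Multiplicative Number Theory I* (CUP 2007), §5.1,
  (5.15)–(5.16): weights `w(x)` as inverse Mellin transforms of kernels `K(s)` ("we may start with
  a kernel `K(s)`, and define the weight `w(x)` to be its inverse Mellin transform"); here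
  `K(w) = ω₁(w)/w`, `w = g`. [cite: MontgomeryVaughan2007, §5.1 (5.15)–(5.16)]
-/

noncomputable section

open Complex Real Set MeasureTheory Filter Topology

namespace Literature.NumberTheory.LFunctions.Zhang2022.GaussWeight

/-! ### §1. The objects -/

/-- `ω₁(w) = exp{w²/(4Λ)}`; the source takes `Λ = 𝓛³⁰`, `𝓛 = log D`.
[cite: Zhang2022LandauSiegel, §4 p. 8] -/
def omega1 (Λ : ℝ) (w : ℂ) : ℂ := cexp (w ^ 2 / ((4 * Λ : ℝ) : ℂ))

/-- The Gaussian `e^{−Λu²}`. [folklore] -/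
def gauss (Λ u : ℝ) : ℝ := rexp (-Λ * u ^ 2)

/-- The weight `g(x) = √(Λ/π) ∫_{u ≤ log x} e^{−Λu²} du`, i.e. (4.1) after `t = √Λ u`
(`gWeight_eq_erf_form`); the source's definition `(2πi)⁻¹∫_{(c)} x^w ω₁(w) dw/w` is recovered in
`gWeight_eq_verticalIntegral`. [cite: Zhang2022LandauSiegel, §4 (4.1)] -/
def gWeight (Λ x : ℝ) : ℝ := Real.sqrt (Λ / π) * ∫ u in Iic (Real.log x), gauss Λ u

/-- The Mellin–Perron kernel on the line `Re w = c`: `K(t) = y^{c+it} ω₁(c+it) (c+it)⁻¹`.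
[cite: Zhang2022LandauSiegel, §4 p. 8] -/
def kernel (Λ c y : ℝ) (t : ℝ) : ℂ :=
  (y : ℂ) ^ ((c : ℂ) + t * I) * omega1 Λ (c + t * I) / (c + t * I)

/-- The Fubini integrand `F(t,u) = ω₁(c+it) e^{(c+it)u}`. [folklore] -/
def fub (Λ c : ℝ) (z : ℝ × ℝ) : ℂ := omega1 Λ (c + z.1 * I) * cexp ((c + z.1 * I) * z.2)

variable {Λ c x y : ℝ}

/-! ### §2. Gaussian bookkeeping -/

/-- [folklore] -/
theorem gauss_pos (Λ u : ℝ) : 0 < gauss Λ u := Real.exp_pos _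

/-- [folklore] -/
theorem gauss_neg (Λ u : ℝ) : gauss Λ (-u) = gauss Λ u := by simp [gauss]

/-- [folklore] -/
theorem continuous_gauss (Λ : ℝ) : Continuous (gauss Λ) := by unfold gauss; fun_prop

/-- [folklore] -/
theorem integrable_gauss (hΛ : 0 < Λ) : Integrable (gauss Λ) := integrable_exp_neg_mul_sq hΛ

/-- `∫_ℝ e^{−Λu²} du = √(π/Λ)`. [folklore] -/
theorem integral_gauss (Λ : ℝ) : ∫ u, gauss Λ u = Real.sqrt (π / Λ) := integral_gaussian Λ

/-- `∫₀^∞ e^{−Λu²} du = ½√(π/Λ)`. [folklore] -/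
theorem integral_gauss_Ioi_zero (Λ : ℝ) :
    ∫ u in Ioi (0 : ℝ), gauss Λ u = Real.sqrt (π / Λ) / 2 := integral_gaussian_Ioi Λ

/-- `√(Λ/π)·√(π/Λ) = 1`. [folklore] -/
theorem sqrt_mul_sqrt (hΛ : 0 < Λ) : Real.sqrt (Λ / π) * Real.sqrt (π / Λ) = 1 := by
  have h : Λ / π * (π / Λ) = 1 := by field_simp
  rw [← Real.sqrt_mul (div_pos hΛ pi_pos).le, h, Real.sqrt_one]

/-- `∫_{u ≤ L} + ∫_{u > L} = ∫_ℝ`. [folklore] -/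
theorem integral_Iic_add_Ioi (hΛ : 0 < Λ) (L : ℝ) :
    (∫ u in Iic L, gauss Λ u) + ∫ u in Ioi L, gauss Λ u = Real.sqrt (π / Λ) := by
  rw [← integral_gauss Λ, ← integral_add_compl (measurableSet_Iic (a := L)) (integrable_gauss hΛ),
    compl_Iic]

/-- `g(x) + √(Λ/π)∫_{u > log x} e^{−Λu²} du = 1`. [cite: Zhang2022LandauSiegel, §4 (4.1)–(4.2)] -/
theorem gWeight_add_tail (hΛ : 0 < Λ) (x : ℝ) :
    gWeight Λ x + Real.sqrt (Λ / π) * ∫ u in Ioi (Real.log x), gauss Λ u = 1 := by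
  rw [gWeight, ← mul_add, integral_Iic_add_Ioi hΛ, sqrt_mul_sqrt hΛ]

/-- **Gaussian tail**: for `L ≥ 0`, `∫_{u > L} e^{−Λu²} du ≤ e^{−ΛL²}·½√(π/Λ)`
(shift `u = v + L` and `(v+L)² ≥ v² + L²`). [folklore] -/
theorem integral_gauss_Ioi_le (hΛ : 0 < Λ) {L : ℝ} (hL : 0 ≤ L) :
    ∫ u in Ioi L, gauss Λ u ≤ gauss Λ L * (Real.sqrt (π / Λ) / 2) := by
  have hmp : MeasurePreserving (fun v : ℝ => v + L) volume volume :=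
    measurePreserving_add_right volume L
  have hme : MeasurableEmbedding (fun v : ℝ => v + L) :=
    (Homeomorph.addRight L).measurableEmbedding
  have hpre : (fun v : ℝ => v + L) ⁻¹' Ioi L = Ioi 0 := by ext v; simp
  have h1 : ∫ u in Ioi L, gauss Λ u = ∫ v in Ioi (0 : ℝ), gauss Λ (v + L) := by
    rw [← hmp.setIntegral_preimage_emb hme (gauss Λ) (Ioi L), hpre]
  have hint : IntegrableOn (fun v => gauss Λ (v + L)) (Ioi 0) :=
    ((integrable_gauss hΛ).comp_add_right L).integrableOn
  rw [h1]
  calc ∫ v in Ioi (0 : ℝ), gauss Λ (v + L)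
      ≤ ∫ v in Ioi (0 : ℝ), gauss Λ L * gauss Λ v := by
        refine setIntegral_mono_on hint ((integrable_gauss hΛ).integrableOn.const_mul _)
          measurableSet_Ioi (fun v hv => ?_)
        have hv : 0 < v := hv
        rw [gauss, gauss, gauss, ← Real.exp_add]
        refine Real.exp_le_exp.mpr ?_
        have : 0 ≤ Λ * (v * L) := by positivity
        nlinarith
    _ = gauss Λ L * (Real.sqrt (π / Λ) / 2) := by
        rw [integral_const_mul, integral_gauss_Ioi_zero]

/-! ### §3. `0 < g < 1`, monotonicity, (4.2), (4.3) -/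

/-- `∫_{u ≤ L} e^{−Λu²} du > 0`. [folklore] -/
theorem integral_gauss_Iic_pos (hΛ : 0 < Λ) (L : ℝ) : 0 < ∫ u in Iic L, gauss Λ u := by
  rw [setIntegral_pos_iff_support_of_nonneg_ae (ae_of_all _ (fun u => (gauss_pos Λ u).le))
    (integrable_gauss hΛ).integrableOn]
  have hsupp : Function.support (gauss Λ) = univ := by
    ext u
    simp [Function.mem_support, (gauss_pos Λ u).ne']
  rw [hsupp, univ_inter, Real.volume_Iic]
  simp

/-- `∫_{u > L} e^{−Λu²} du > 0`. [folklore] -/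
theorem integral_gauss_Ioi_pos (hΛ : 0 < Λ) (L : ℝ) : 0 < ∫ u in Ioi L, gauss Λ u := by
  rw [setIntegral_pos_iff_support_of_nonneg_ae (ae_of_all _ (fun u => (gauss_pos Λ u).le))
    (integrable_gauss hΛ).integrableOn]
  have hsupp : Function.support (gauss Λ) = univ := by
    ext u
    simp [Function.mem_support, (gauss_pos Λ u).ne']
  rw [hsupp, univ_inter, Real.volume_Ioi]
  simp

/-- **`0 < g(x)`** ("it satisfies `0 < g(x) < 1`"). [cite: Zhang2022LandauSiegel, §4 after (4.1)] -/
theorem gWeight_pos (hΛ : 0 < Λ) (x : ℝ) : 0 < gWeight Λ x :=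
  mul_pos (Real.sqrt_pos.mpr (div_pos hΛ pi_pos)) (integral_gauss_Iic_pos hΛ _)

/-- `1 − g(x) = √(Λ/π)∫_{u > log x} e^{−Λu²} du`. [cite: Zhang2022LandauSiegel, §4 (4.2)] -/
theorem one_sub_gWeight (hΛ : 0 < Λ) (x : ℝ) :
    1 - gWeight Λ x = Real.sqrt (Λ / π) * ∫ u in Ioi (Real.log x), gauss Λ u := by
  have := gWeight_add_tail hΛ x
  linarith

/-- **`g(x) < 1`**. [cite: Zhang2022LandauSiegel, §4 after (4.1)] -/
theorem gWeight_lt_one (hΛ : 0 < Λ) (x : ℝ) : gWeight Λ x < 1 := by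
  have h := one_sub_gWeight hΛ x
  have hpos : 0 < Real.sqrt (Λ / π) * ∫ u in Ioi (Real.log x), gauss Λ u :=
    mul_pos (Real.sqrt_pos.mpr (div_pos hΛ pi_pos)) (integral_gauss_Ioi_pos hΛ _)
  linarith

/-- **`g` is increasing** on `(0, ∞)`. [cite: Zhang2022LandauSiegel, §4 after (4.1)] -/
theorem gWeight_mono (hΛ : 0 < Λ) (hx : 0 < x) (hxy : x ≤ y) : gWeight Λ x ≤ gWeight Λ y := by
  unfold gWeight
  refine mul_le_mul_of_nonneg_left ?_ (Real.sqrt_nonneg _)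
  refine setIntegral_mono_set (integrable_gauss hΛ).integrableOn
    (ae_of_all _ (fun u => (gauss_pos Λ u).le)) (ae_of_all _ (fun u hu => ?_))
  exact Iic_subset_Iic.mpr (Real.log_le_log hx hxy) hu

/-- **(4.2)**, two-sided: for `x ≥ 1`, `0 ≤ 1 − g(x) ≤ ½ exp{−Λ log²x}`.
[cite: Zhang2022LandauSiegel, §4 (4.2)] -/
theorem one_sub_gWeight_le (hΛ : 0 < Λ) (hx : 1 ≤ x) :
    0 ≤ 1 - gWeight Λ x ∧ 1 - gWeight Λ x ≤ (1 / 2) * rexp (-Λ * (Real.log x) ^ 2) := by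
  refine ⟨by linarith [gWeight_lt_one hΛ x], ?_⟩
  rw [one_sub_gWeight hΛ x]
  have hL : 0 ≤ Real.log x := Real.log_nonneg hx
  calc Real.sqrt (Λ / π) * ∫ u in Ioi (Real.log x), gauss Λ u
      ≤ Real.sqrt (Λ / π) * (gauss Λ (Real.log x) * (Real.sqrt (π / Λ) / 2)) :=
        mul_le_mul_of_nonneg_left (integral_gauss_Ioi_le hΛ hL) (Real.sqrt_nonneg _)
    _ = (1 / 2) * rexp (-Λ * (Real.log x) ^ 2) := by
        have h := sqrt_mul_sqrt hΛ
        rw [gauss]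
        calc Real.sqrt (Λ / π) * (rexp (-Λ * Real.log x ^ 2) * (Real.sqrt (π / Λ) / 2))
            = (Real.sqrt (Λ / π) * Real.sqrt (π / Λ)) / 2 * rexp (-Λ * Real.log x ^ 2) := by
              ring
          _ = (1 / 2) * rexp (-Λ * (Real.log x) ^ 2) := by rw [h]

/-- **(4.2)** as printed: for `x ≥ 1`, `|g(x) − 1| ≤ ½ exp{−Λ log²x}` (so
`g(x) = 1 + O(exp{−𝓛³⁰ log²x})` with `Λ = 𝓛³⁰`). [cite: Zhang2022LandauSiegel, §4 (4.2)] -/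
theorem abs_gWeight_sub_one_le (hΛ : 0 < Λ) (hx : 1 ≤ x) :
    |gWeight Λ x - 1| ≤ (1 / 2) * rexp (-Λ * (Real.log x) ^ 2) := by
  obtain ⟨h0, h1⟩ := one_sub_gWeight_le hΛ hx
  rw [abs_sub_comm, abs_of_nonneg h0]
  exact h1

/-- `g(x) = √(Λ/π)∫_{u > −log x} e^{−Λu²} du` (the Gaussian is even).
[cite: Zhang2022LandauSiegel, §4 (4.3)] -/
theorem gWeight_eq_integral_Ioi (x : ℝ) :
    gWeight Λ x = Real.sqrt (Λ / π) * ∫ u in Ioi (-Real.log x), gauss Λ u := by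
  rw [gWeight]
  congr 1
  have h := integral_comp_neg_Ioi (-Real.log x) (gauss Λ)
  rw [neg_neg] at h
  rw [← h]
  exact setIntegral_congr_fun measurableSet_Ioi (fun u _ => gauss_neg Λ u)

/-- **(4.3)** as printed: for `0 < x ≤ 1`, `g(x) ≤ ½ exp{−Λ log²x}` (so
`g(x) = O(exp{−𝓛³⁰ log²x})`). [cite: Zhang2022LandauSiegel, §4 (4.3)] -/
theorem gWeight_le (hΛ : 0 < Λ) (hx : 0 < x) (hx1 : x ≤ 1) :
    gWeight Λ x ≤ (1 / 2) * rexp (-Λ * (Real.log x) ^ 2) := by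
  rw [gWeight_eq_integral_Ioi]
  have hL : 0 ≤ -Real.log x := by
    have := Real.log_nonpos hx.le hx1
    linarith
  calc Real.sqrt (Λ / π) * ∫ u in Ioi (-Real.log x), gauss Λ u
      ≤ Real.sqrt (Λ / π) * (gauss Λ (-Real.log x) * (Real.sqrt (π / Λ) / 2)) :=
        mul_le_mul_of_nonneg_left (integral_gauss_Ioi_le hΛ hL) (Real.sqrt_nonneg _)
    _ = (1 / 2) * rexp (-Λ * (Real.log x) ^ 2) := by
        have h := sqrt_mul_sqrt hΛ
        rw [gauss_neg, gauss]
        calc Real.sqrt (Λ / π) * (rexp (-Λ * Real.log x ^ 2) * (Real.sqrt (π / Λ) / 2))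
            = (Real.sqrt (Λ / π) * Real.sqrt (π / Λ)) / 2 * rexp (-Λ * Real.log x ^ 2) := by
              ring
          _ = (1 / 2) * rexp (-Λ * (Real.log x) ^ 2) := by rw [h]

/-! ### §4. The line `Re w = c`: norms, the Gaussian line integral, Fubini -/

/-- `|ω₁(c+it)| = exp{(c² − t²)/(4Λ)}`. [folklore] -/
theorem norm_omega1 (Λ c t : ℝ) : ‖omega1 Λ (c + t * I)‖ = rexp ((c ^ 2 - t ^ 2) / (4 * Λ)) := by
  rw [omega1, Complex.norm_exp, Complex.div_ofReal_re]
  congr 2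
  simp [sq]

/-- `|e^{(c+it)u}| = e^{cu}` for real `u`. [folklore] -/
theorem norm_cexp_line_mul (c t u : ℝ) : ‖cexp ((c + t * I) * u)‖ = rexp (c * u) := by
  rw [Complex.norm_exp]
  congr 1
  simp

/-- `c + it ≠ 0` for `c ≠ 0`. [folklore] -/
theorem line_ne_zero (hc : c ≠ 0) (t : ℝ) : (c : ℂ) + t * I ≠ 0 := by
  intro h
  have := congrArg Complex.re h
  simp at this
  exact hc this

/-- `c ≤ |c + it|`. [folklore] -/
theorem le_norm_line (c t : ℝ) : c ≤ ‖(c : ℂ) + t * I‖ := by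
  simpa using Complex.re_le_norm ((c : ℂ) + t * I)

/-- `y^w = e^{w log y}` for `y > 0`. [folklore] -/
theorem cpow_eq_exp_log (hy : 0 < y) (w : ℂ) : (y : ℂ) ^ w = cexp (w * Real.log y) := by
  rw [cpow_def_of_ne_zero (ofReal_ne_zero.mpr hy.ne'), ← Complex.ofReal_log hy.le, mul_comm]

/-- The source's first step "`x^w/w = ∫₀ˣ y^{w−1} dy`", after `y = e^u`: for `Re w > 0` and
`y > 0`, `y^w / w = ∫_{u ≤ log y} e^{wu} du`. [cite: Zhang2022LandauSiegel, §4 p. 8] -/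
theorem cpow_div_eq_integral (hy : 0 < y) {w : ℂ} (hw : 0 < w.re) :
    (y : ℂ) ^ w / w = ∫ u in Iic (Real.log y), cexp (w * u) := by
  rw [integral_exp_mul_complex_Iic hw, cpow_eq_exp_log hy]

/-- **The Gaussian line integral** (the source's "`(2πi)⁻¹∫_{(c)} exp{(log y)w + w²/(4𝓛³⁰)} dw
= (𝓛¹⁵/√π)exp{−𝓛³⁰(log y)²}`", times `2π`, with `u = log y`):
`∫_ℝ ω₁(c+it) e^{(c+it)u} dt = √(4πΛ)·e^{−Λu²}`. [cite: Zhang2022LandauSiegel, §4 p. 8] -/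
theorem integral_omega1_mul_exp (hΛ : 0 < Λ) (c u : ℝ) :
    ∫ t : ℝ, omega1 Λ (c + t * I) * cexp ((c + t * I) * u)
      = ((Real.sqrt (4 * π * Λ) * gauss Λ u : ℝ) : ℂ) := by
  have hΛ' : (Λ : ℂ) ≠ 0 := ofReal_ne_zero.mpr hΛ.ne'
  -- the exponent as a quadratic polynomial in `t`
  have E1 : ∀ t : ℝ, omega1 Λ (c + t * I) * cexp ((c + t * I) * u)
      = cexp (-(((1 / (4 * Λ) : ℝ) : ℂ)) * (t : ℂ) ^ 2
          + (((u + c / (2 * Λ) : ℝ) : ℂ) * I) * t + ((c * u + c ^ 2 / (4 * Λ) : ℝ) : ℂ)) := by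
    intro t
    rw [omega1, ← Complex.exp_add]
    congr 1
    push_cast
    linear_combination ((t : ℂ) ^ 2 / (4 * (Λ : ℂ))) * Complex.I_sq
  have hb : (-(((1 / (4 * Λ) : ℝ) : ℂ))).re < 0 := by
    rw [neg_re, ofReal_re, neg_lt_zero]
    positivity
  simp_rw [E1]
  rw [integral_cexp_quadratic hb]
  have h1 : (π : ℂ) / -(-(((1 / (4 * Λ) : ℝ) : ℂ))) = ((4 * π * Λ : ℝ) : ℂ) := by
    rw [neg_neg]
    push_cast
    field_simp
  have h2 : ((π : ℂ) / -(-(((1 / (4 * Λ) : ℝ) : ℂ)))) ^ (1 / 2 : ℂ)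
      = ((Real.sqrt (4 * π * Λ) : ℝ) : ℂ) := by
    rw [h1, show (1 / 2 : ℂ) = ((1 / 2 : ℝ) : ℂ) by push_cast; ring,
      ← ofReal_cpow (by positivity), Real.sqrt_eq_rpow]
  have h3 : (((c * u + c ^ 2 / (4 * Λ) : ℝ) : ℂ))
      - (((u + c / (2 * Λ) : ℝ) : ℂ) * I) ^ 2 / (4 * -(((1 / (4 * Λ) : ℝ) : ℂ)))
      = ((-Λ * u ^ 2 : ℝ) : ℂ) := by
    rw [mul_pow, Complex.I_sq]
    push_cast
    field_simp
    ring
  rw [h2, h3, gauss, ← Complex.ofReal_exp, ← Complex.ofReal_mul]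

/-- `|F(t,u)| = e^{(c²−t²)/(4Λ)} e^{cu}`. [folklore] -/
theorem norm_fub (Λ c : ℝ) (z : ℝ × ℝ) :
    ‖fub Λ c z‖ = rexp ((c ^ 2 - z.1 ^ 2) / (4 * Λ)) * rexp (c * z.2) := by
  rw [fub, norm_mul, norm_omega1, norm_cexp_line_mul]

/-- [folklore] -/
theorem continuous_fub (Λ c : ℝ) : Continuous (fub Λ c) := by
  unfold fub omega1
  fun_prop

/-- **Fubini hypothesis**: `F` is integrable on `ℝ × (−∞, L]` ("changing the order of
integration" is licit). [folklore] -/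
theorem integrable_fub (hΛ : 0 < Λ) (hc : 0 < c) (L : ℝ) :
    Integrable (fub Λ c) ((volume : Measure ℝ).prod (volume.restrict (Iic L))) := by
  have h1 : Integrable (fun t : ℝ => rexp ((c ^ 2 - t ^ 2) / (4 * Λ))) (volume : Measure ℝ) := by
    have : (fun t : ℝ => rexp ((c ^ 2 - t ^ 2) / (4 * Λ)))
        = fun t => rexp (c ^ 2 / (4 * Λ)) * rexp (-(1 / (4 * Λ)) * t ^ 2) := by
      funext t
      rw [← Real.exp_add]
      congr 1
      ring
    rw [this]
    exact (integrable_exp_neg_mul_sq (by positivity)).const_mul _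
  have h2 : Integrable (fun u : ℝ => rexp (c * u)) (volume.restrict (Iic L)) :=
    integrableOn_exp_mul_Iic hc L
  refine (h1.mul_prod h2).mono' (continuous_fub Λ c).aestronglyMeasurable
    (ae_of_all _ (fun z => ?_))
  rw [norm_fub]

/-! ### §5. The source's definition of `g` as a theorem: `(2πi)⁻¹∫_{(c)} x^w ω₁(w) dw/w = g(x)` -/

/-- **(4.1) ⇔ the contour-integral definition.** For `Λ > 0`, `c > 0`, `x > 0`:
`(1/2π) ∫_ℝ x^{c+it} ω₁(c+it) (c+it)⁻¹ dt = g(x) = √(Λ/π)∫_{u ≤ log x} e^{−Λu²} du`, i.e.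
`(2πi)⁻¹ ∫_{(c)} x^w ω₁(w) dw/w = g(x)` — the printed derivation of (4.1) ("changing the order of
integration"). [cite: Zhang2022LandauSiegel, §4 (4.1)] -/
theorem gWeight_eq_verticalIntegral (hΛ : 0 < Λ) (hc : 0 < c) (hx : 0 < x) :
    (1 / (2 * π) : ℂ) * ∫ t : ℝ, (x : ℂ) ^ ((c : ℂ) + t * I) * omega1 Λ (c + t * I) / (c + t * I)
      = (gWeight Λ x : ℂ) := by
  have hw : ∀ t : ℝ, 0 < ((c : ℂ) + t * I).re := fun t => by simpa using hc
  -- Step 1 [the source: `x^w/w = ∫₀ˣ y^{w−1} dy`]: the integrand is `∫_{u ≤ log x} F(t,u) du`.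
  have step1 : (fun t : ℝ => (x : ℂ) ^ ((c : ℂ) + t * I) * omega1 Λ (c + t * I) / (c + t * I))
      = fun t : ℝ => ∫ u in Iic (Real.log x), fub Λ c (t, u) := by
    funext t
    rw [mul_comm, mul_div_assoc, cpow_div_eq_integral hx (hw t), ← integral_const_mul]
    rfl
  -- Step 2 [the source: "by changing the order of integration"]: Fubini.
  have step2 : ∫ t : ℝ, ∫ u in Iic (Real.log x), fub Λ c (t, u)
      = ∫ u in Iic (Real.log x), ∫ t : ℝ, fub Λ c (t, u) :=
    integral_integral_swap (integrable_fub hΛ hc (Real.log x))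
  -- Step 3 [the source's Gaussian evaluation]: the inner integral.
  have step3 : (fun u : ℝ => ∫ t : ℝ, fub Λ c (t, u))
      = fun u : ℝ => ((Real.sqrt (4 * π * Λ) * gauss Λ u : ℝ) : ℂ) := by
    funext u
    exact integral_omega1_mul_exp hΛ c u
  rw [step1, step2, step3, integral_complex_ofReal, integral_const_mul, gWeight]
  -- Step 4 [the source's substitution `t = 𝓛¹⁵ log y`, here only the constant]: √(4πΛ)/(2π) = √(Λ/π).
  have hs : Real.sqrt (4 * π * Λ) = 2 * π * Real.sqrt (Λ / π) := by
    rw [show 4 * π * Λ = (2 * π) ^ 2 * (Λ / π) by field_simp; ring,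
      Real.sqrt_mul (by positivity), Real.sqrt_sq (by positivity)]
  have hπ : (π : ℂ) ≠ 0 := ofReal_ne_zero.mpr Real.pi_ne_zero
  rw [hs]
  push_cast
  field_simp

/-- The same with the kernel bundled: `(1/2π)∫_ℝ K_x(t) dt = g(x)`.
[cite: Zhang2022LandauSiegel, §4 (4.1)] -/
theorem integral_kernel (hΛ : 0 < Λ) (hc : 0 < c) (hx : 0 < x) :
    (1 / (2 * π) : ℂ) * ∫ t : ℝ, kernel Λ c x t = (gWeight Λ x : ℂ) :=
  gWeight_eq_verticalIntegral hΛ hc hx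

/-- `∫_ℝ K_x(t) dt = 2π·g(x)`. [cite: Zhang2022LandauSiegel, §4 (4.1)] -/
theorem integral_kernel' (hΛ : 0 < Λ) (hc : 0 < c) (hx : 0 < x) :
    ∫ t : ℝ, kernel Λ c x t = 2 * π * (gWeight Λ x : ℂ) := by
  have h := integral_kernel hΛ hc hx
  have hπ : (π : ℂ) ≠ 0 := ofReal_ne_zero.mpr Real.pi_ne_zero
  rw [← h]
  field_simp

/-! ### §6. (4.1) literally: `g(x) = (1/√π)∫_{−∞}^{√Λ log x} e^{−t²} dt` -/

/-- Linear substitution on a left half-line: `∫_{x ≤ a} g(bx) dx = b⁻¹ ∫_{x ≤ ba} g(x) dx`, `b > 0`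
(the `Iic` twin of Mathlib's `integral_comp_mul_left_Ioi`). [folklore] -/
theorem integral_comp_mul_left_Iic (g : ℝ → ℝ) (a : ℝ) {b : ℝ} (hb : 0 < b) :
    (∫ x in Iic a, g (b * x)) = b⁻¹ * ∫ x in Iic (b * a), g x := by
  have : ∀ c : ℝ, MeasurableSet (Iic c) := fun c => measurableSet_Iic
  rw [← integral_indicator (this a), ← integral_indicator (this (b * a)),
    ← abs_of_pos (inv_pos.mpr hb), ← smul_eq_mul, ← Measure.integral_comp_mul_left]
  congr
  ext1 x
  by_cases hx : x ≤ a
  · have h' : b * x ≤ b * a := mul_le_mul_of_nonneg_left hx hb.le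
    simp [hx, h']
  · have h' : ¬ b * x ≤ b * a := fun h => hx (le_of_mul_le_mul_left h hb)
    simp [hx, h']

/-- **(4.1) as printed** ("This yields, by substituting `t = 𝓛¹⁵ log y`,
`g(x) = (1/√π)∫_{−∞}^{𝓛¹⁵ log x} exp{−t²} dt`"; here `√Λ` for `𝓛¹⁵`).
[cite: Zhang2022LandauSiegel, §4 (4.1)] -/
theorem gWeight_eq_erf_form (hΛ : 0 < Λ) (x : ℝ) :
    gWeight Λ x = (1 / Real.sqrt π) * ∫ t in Iic (Real.sqrt Λ * Real.log x), rexp (-t ^ 2) := by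
  have hsq : 0 < Real.sqrt Λ := Real.sqrt_pos.mpr hΛ
  have h1 : ∫ u in Iic (Real.log x), gauss Λ u
      = ∫ u in Iic (Real.log x), (fun t => rexp (-t ^ 2)) (Real.sqrt Λ * u) := by
    refine setIntegral_congr_fun measurableSet_Iic (fun u _ => ?_)
    simp only [gauss, mul_pow, Real.sq_sqrt hΛ.le, neg_mul]
  rw [gWeight, h1, integral_comp_mul_left_Iic (fun t => rexp (-t ^ 2)) (Real.log x) hsq, ← mul_assoc]
  congr 1
  rw [Real.sqrt_div hΛ.le]
  field_simp

/-! ### §7. The kernel `K_y(t) = y^{c+it} ω₁(c+it)(c+it)⁻¹`: size and integrability -/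

/-- `|K_y(t)| = y^c e^{(c²−t²)/(4Λ)} |c+it|⁻¹`. [folklore] -/
theorem norm_kernel (Λ : ℝ) (hy : 0 < y) (c t : ℝ) :
    ‖kernel Λ c y t‖ = y ^ c * rexp ((c ^ 2 - t ^ 2) / (4 * Λ)) / ‖(c : ℂ) + t * I‖ := by
  have hre : ((c : ℂ) + t * I).re = c := by simp
  rw [kernel, norm_div, norm_mul, norm_omega1, Complex.norm_cpow_eq_rpow_re_of_pos hy, hre]

/-- [folklore] -/
theorem continuous_kernel (Λ : ℝ) (hc : c ≠ 0) (hy : 0 < y) : Continuous (kernel Λ c y) := by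
  have h1 : Continuous fun t : ℝ => (y : ℂ) ^ ((c : ℂ) + t * I) :=
    Continuous.const_cpow (by fun_prop) (Or.inl (ofReal_ne_zero.mpr hy.ne'))
  have h2 : Continuous fun t : ℝ => omega1 Λ (c + t * I) := by unfold omega1; fun_prop
  have h3 : Continuous fun t : ℝ => ((c : ℂ) + t * I) := by fun_prop
  exact (h1.mul h2).div h3 (fun t => line_ne_zero hc t)

/-- The kernel is absolutely integrable on the line (`|K_y(t)| ≤ (y^c e^{c²/(4Λ)}/c)·e^{−t²/(4Λ)}`).
[folklore] -/
theorem integrable_kernel (hΛ : 0 < Λ) (hc : 0 < c) (hy : 0 < y) : Integrable (kernel Λ c y) := by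
  have hg : Integrable
      (fun t : ℝ => (y ^ c * rexp (c ^ 2 / (4 * Λ)) / c) * rexp (-(1 / (4 * Λ)) * t ^ 2)) :=
    (integrable_exp_neg_mul_sq (by positivity)).const_mul _
  refine hg.mono' (continuous_kernel Λ hc.ne' hy).aestronglyMeasurable (ae_of_all _ (fun t => ?_))
  rw [norm_kernel Λ hy]
  have hw : c ≤ ‖(c : ℂ) + t * I‖ := le_norm_line c t
  have hwpos : 0 < ‖(c : ℂ) + t * I‖ := hc.trans_le hw
  rw [div_le_iff₀ hwpos]
  have hsplit : rexp ((c ^ 2 - t ^ 2) / (4 * Λ))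
      = rexp (c ^ 2 / (4 * Λ)) * rexp (-(1 / (4 * Λ)) * t ^ 2) := by
    rw [← Real.exp_add]
    congr 1
    ring
  rw [hsplit]
  have hyc : 0 < y ^ c := Real.rpow_pos_of_pos hy c
  calc y ^ c * (rexp (c ^ 2 / (4 * Λ)) * rexp (-(1 / (4 * Λ)) * t ^ 2))
      = (y ^ c * rexp (c ^ 2 / (4 * Λ)) / c * rexp (-(1 / (4 * Λ)) * t ^ 2)) * c := by
        field_simp
    _ ≤ (y ^ c * rexp (c ^ 2 / (4 * Λ)) / c * rexp (-(1 / (4 * Λ)) * t ^ 2))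
          * ‖(c : ℂ) + t * I‖ := by
        gcongr

/-- The line constant `M(Λ,c) = ∫_ℝ e^{(c²−t²)/(4Λ)} |c+it|⁻¹ dt`. [folklore] -/
def lineConst (Λ c : ℝ) : ℝ := ∫ t : ℝ, rexp ((c ^ 2 - t ^ 2) / (4 * Λ)) / ‖(c : ℂ) + t * I‖

/-- `∫_ℝ |K_y(t)| dt = y^c·M(Λ,c)`. [folklore] -/
theorem integral_norm_kernel (Λ : ℝ) (hy : 0 < y) (c : ℝ) :
    ∫ t : ℝ, ‖kernel Λ c y t‖ = y ^ c * lineConst Λ c := by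
  simp_rw [norm_kernel Λ hy, mul_div_assoc]
  rw [integral_const_mul, lineConst]

/-- `(X/y)^w = X^w / y^w` for positive reals `X, y`. [folklore] -/
theorem div_cpow_line {X : ℝ} (hX : 0 < X) (hy : 0 < y) (w : ℂ) :
    ((X / y : ℝ) : ℂ) ^ w = (X : ℂ) ^ w / (y : ℂ) ^ w := by
  rw [cpow_eq_exp_log (div_pos hX hy), cpow_eq_exp_log hX, cpow_eq_exp_log hy,
    Real.log_div hX.ne' hy.ne', ← Complex.exp_sub]
  congr 1
  push_cast
  ring

/-! ### §8. How the weight is used: `(2πi)⁻¹∫_{(c)} (∑ₙ aₙ n^{−s−w}) X^w ω₁(w) dw/w = ∑ₙ aₙn^{−s}g(X/n)` -/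

open LSeries

/-- Termwise: `aₙ n^{−(s+w)} · X^w ω₁(w)/w = aₙ n^{−s} · (X/n)^w ω₁(w)/w`.
[cite: Zhang2022LandauSiegel, §4, proof of Lemma 4.4 (first display)] -/
theorem term_mul_kernel (Λ c : ℝ) {X : ℝ} (hX : 0 < X) (a : ℕ → ℂ) (s : ℂ) (n : ℕ) (t : ℝ) :
    term a (s + (c + t * I)) n * kernel Λ c X t = term a s n * kernel Λ c (X / n) t := by
  rcases eq_or_ne n 0 with rfl | hn
  · simp [term_zero]
  have hn' : (0 : ℝ) < n := Nat.cast_pos.mpr (Nat.pos_of_ne_zero hn)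
  rw [term_of_ne_zero hn, term_of_ne_zero hn, kernel, kernel, div_cpow_line hX hn',
    Complex.ofReal_natCast, Complex.cpow_add _ _ (Nat.cast_ne_zero.mpr hn)]
  ring

/-- [folklore] -/
theorem integrable_term_mul_kernel (hΛ : 0 < Λ) (hc : 0 < c) {X : ℝ} (hX : 0 < X) (a : ℕ → ℂ)
    (s : ℂ) (n : ℕ) : Integrable (fun t : ℝ => term a s n * kernel Λ c (X / n) t) := by
  rcases eq_or_ne n 0 with rfl | hn
  · simp only [term_zero, zero_mul]
    exact integrable_zero _ _ _
  have hn' : (0 : ℝ) < n := Nat.cast_pos.mpr (Nat.pos_of_ne_zero hn)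
  exact (integrable_kernel hΛ hc (div_pos hX hn')).const_mul _

/-- `∫_ℝ |aₙn^{−s} K_{X/n}(t)| dt = |aₙ| n^{−(σ+c)} · X^c M(Λ,c)`. [folklore] -/
theorem integral_norm_term_mul_kernel (Λ c : ℝ) {X : ℝ} (hX : 0 < X) (a : ℕ → ℂ) (s : ℂ)
    (n : ℕ) : ∫ t : ℝ, ‖term a s n * kernel Λ c (X / n) t‖
      = ‖term a (s + c) n‖ * (X ^ c * lineConst Λ c) := by
  rcases eq_or_ne n 0 with rfl | hn
  · simp [term_zero]
  have hn' : (0 : ℝ) < n := Nat.cast_pos.mpr (Nat.pos_of_ne_zero hn)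
  simp_rw [norm_mul]
  rw [integral_const_mul, integral_norm_kernel Λ (div_pos hX hn'), norm_term_eq, norm_term_eq,
    if_neg hn, if_neg hn, Real.div_rpow hX.le hn'.le, add_re, ofReal_re, Real.rpow_add hn']
  ring

/-- Termwise value: `∫_ℝ aₙn^{−s} K_{X/n}(t) dt = 2π · aₙ n^{−s} g(X/n)`.
[cite: Zhang2022LandauSiegel, §4 (4.1)] -/
theorem integral_term_mul_kernel (hΛ : 0 < Λ) (hc : 0 < c) {X : ℝ} (hX : 0 < X) (a : ℕ → ℂ)
    (s : ℂ) (n : ℕ) : ∫ t : ℝ, term a s n * kernel Λ c (X / n) t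
      = 2 * π * (term a s n * (gWeight Λ (X / n) : ℂ)) := by
  rcases eq_or_ne n 0 with rfl | hn
  · simp [term_zero]
  have hn' : (0 : ℝ) < n := Nat.cast_pos.mpr (Nat.pos_of_ne_zero hn)
  rw [integral_const_mul, integral_kernel' hΛ hc (div_pos hX hn')]
  ring

/-- **The Mellin identity through which §4 uses `g`** (Dirichlet polynomials, e.g. the finite sums
`F`, `N` of the manuscript): for a finite set `S` of indices,
`(1/2π)∫_ℝ (∑_{n∈S} aₙ n^{−(s+c+it)}) K_X(t) dt = ∑_{n∈S} aₙ n^{−s} g(X/n)`.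
[cite: Zhang2022LandauSiegel, §4, proof of Lemma 4.4] -/
theorem integral_sum_mul_kernel (hΛ : 0 < Λ) (hc : 0 < c) {X : ℝ} (hX : 0 < X) (S : Finset ℕ)
    (a : ℕ → ℂ) (s : ℂ) :
    (1 / (2 * π) : ℂ) * ∫ t : ℝ, (∑ n ∈ S, term a (s + (c + t * I)) n) * kernel Λ c X t
      = ∑ n ∈ S, term a s n * (gWeight Λ (X / n) : ℂ) := by
  have hπ : (π : ℂ) ≠ 0 := ofReal_ne_zero.mpr Real.pi_ne_zero
  simp_rw [Finset.sum_mul, term_mul_kernel Λ c hX]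
  rw [integral_finsetSum _ (fun n _ => integrable_term_mul_kernel hΛ hc hX a s n)]
  simp_rw [integral_term_mul_kernel hΛ hc hX]
  rw [← Finset.mul_sum]
  field_simp

/-- **The Mellin identity through which §4 uses `g`** (`L`-series form, e.g. the first display of
the proof of Lemma 4.4 with `∑ ν(n)ψ(n)n^{-s} = L(s,ψ)L(s,χψ)`, and the proof of Lemma 5.7): if
`∑ₙ aₙ n^{−(s+c)}` converges absolutely, then
`(1/2π)∫_ℝ L(a, s+c+it) X^{c+it} ω₁(c+it)(c+it)⁻¹ dt = ∑ₙ aₙ n^{−s} g(X/n)` (the interchange of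
`∑` and `∫` by absolute convergence: `∑ₙ ∫|·| = X^c M(Λ,c) ∑ₙ |aₙ| n^{−(σ+c)} < ∞`).
[cite: Zhang2022LandauSiegel, §4, proof of Lemma 4.4] -/
theorem integral_LSeries_mul_kernel (hΛ : 0 < Λ) (hc : 0 < c) {X : ℝ} (hX : 0 < X) {a : ℕ → ℂ}
    {s : ℂ} (hs : LSeriesSummable a (s + c)) :
    (1 / (2 * π) : ℂ) * ∫ t : ℝ, LSeries a (s + (c + t * I)) * kernel Λ c X t
      = ∑' n : ℕ, term a s n * (gWeight Λ (X / n) : ℂ) := by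
  have hπ : (π : ℂ) ≠ 0 := ofReal_ne_zero.mpr Real.pi_ne_zero
  have hsum_eq : (fun t : ℝ => LSeries a (s + (c + t * I)) * kernel Λ c X t)
      = fun t => ∑' n : ℕ, term a s n * kernel Λ c (X / n) t := by
    funext t
    rw [LSeries, ← tsum_mul_right]
    exact tsum_congr (fun n => term_mul_kernel Λ c hX a s n t)
  have hG_sum : Summable (fun n : ℕ => ∫ t : ℝ, ‖term a s n * kernel Λ c (X / n) t‖) := by
    simp_rw [integral_norm_term_mul_kernel Λ c hX a s]
    exact (summable_norm_iff.mpr hs).mul_right _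
  rw [hsum_eq, ← integral_tsum_of_summable_integral_norm
    (fun n => integrable_term_mul_kernel hΛ hc hX a s n) hG_sum]
  simp_rw [integral_term_mul_kernel hΛ hc hX]
  rw [tsum_mul_left]
  field_simp

end Literature.NumberTheory.LFunctions.Zhang2022.GaussWeight
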